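import Mathlib
import HarnessLib
import Literature.NumberTheory.LFunctions.VinogradovMeanValueBound
import Literature.NumberTheory.LFunctions.VinogradovMeanValueHypothesis

/-!
# Vinogradov's mean value theorem, VII: Ivić's Lemma 6.3 with a clean constant, and the
# discharge of the interface `VMVTBound`

Topic `Literature/NumberTheory/LFunctions`. Everything in this file is PROVED (no named facts).

`VinogradovMeanValueBound.lean` (part VI) proves Ivić's Lemma 6.3 (*The Riemann Zeta-Function*,
1985, p. 151) in the form `J_{k,n}([1,P]) ≤ K(n,k)^r · n^{2n²(n+1)} · P^{2k − (n²+n)/2 + c_r}`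
(`VMV.lemma63`), where the factor `n^{2n²(n+1)}` came from using the trivial bound `J ≤ P^{2k}` for
`P < n^{4n}`. Ivić's own treatment of small `P` ((6.30)–(6.32): `J_{k,n}(P) ≤ P^{2n} J_{k−n,n}(P)` and the
induction hypothesis, paying only `P^{c_m − c_{m+1}} = P^{c_m/n} ≤ (n^{4n})^{(n+1)/2}` per step) removes
it; this file runs that argument (with the fixed threshold `n^{4n}` of `VMV.lemma62` in place of Ivić's
`(2n)^{3n(1+1/(n−1))^r}`) and obtains

* `VMV.lemma63_sharp` — for `n ≥ 2`, `k ≥ n² + nr`, all `P ≥ 1`: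
  `J_{k,n}([1,P]) ≤ K'(n,k)^r · P^{2k − (n²+n)/2 + c_r}`, `K'(n,k) = 9^k C₆₂(n,k) n^{2n(n+1)}`
  (`VMV.K63s`; `C₆₂(n,k) = 2·9ⁿ + k^{2n} n! 2^{n²} 3ⁿ`);
* `VMV.K63s_le` — `K'(n,k) ≤ (32n)^{3k}` for `k ≥ n² + n` (elementary: `k^{2n} ≤ 256^k` as `n ≤ √k`);
* `vmvtBound_thirtyTwo : VMVTBound 32` — **Ivić's Lemma 6.3 in the interface form of
  `VinogradovMeanValueHypothesis.lean`** (constant `(32n)^{32kρ}`, for all `P` beyond the threshold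
  there — indeed for all `P ≥ 1`), and `exists_vmvtBound : ∃ A, 1 ≤ A ∧ VMVTBound A`.

So Vinogradov's mean value theorem is a theorem of the tree, and the consumer
"`∀ A ≥ 1, VMVTBound A → ∃ C c > 0, VinogradovRangeBound 10 C c`" of that file closes the chain
`VMVT → zeta sums → ExpSumBound → Richert-type bounds → HasVKZeroFreeRegion` (`ExpSumBoundReduction.lean`,
`RichertBoundsFromExpSum.lean`, `VinogradovKorobovFromRichert.lean`).

## References

* A. Ivić, *The Riemann Zeta-Function*, John Wiley & Sons 1985 (Dover 2003), §6.2, Lemma 6.3 and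
  (6.30)–(6.32), pp. 151–152. [cite: Ivic1985, Lemma 6.3]
-/

noncomputable section

open Finset
open scoped Real

namespace Literature.NumberTheory.LFunctions
namespace VMV

/-! ### The sharp form of Lemma 6.3 -/

/-- The constant per step `K'(n,k) = 9^k C₆₂(n,k) n^{2n(n+1)}`. [cite: Ivic1985, Lemma 6.3 (here in place of `(4n)^{4k}`)] -/
def K63s (n k : ℕ) : ℝ := 9 ^ k * C62 n k * (n : ℝ) ^ (2 * n * (n + 1))

/-- `9^k C₆₂(n,k) ≤ K'(n,k)` (`n ≥ 1`). [folklore] -/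
theorem nine_pow_mul_C62_le_K63s {n : ℕ} (hn : 1 ≤ n) (k : ℕ) : 9 ^ k * C62 n k ≤ K63s n k := by
  unfold K63s
  have h1 : (1 : ℝ) ≤ (n : ℝ) ^ (2 * n * (n + 1)) := one_le_pow₀ (by exact_mod_cast hn)
  have h2 : (0 : ℝ) ≤ 9 ^ k * C62 n k := by have := two_le_C62 n k; positivity
  nlinarith

/-- `n^{2n(n+1)} ≤ K'(n,k)`. [folklore] -/
theorem pow_le_K63s (n k : ℕ) : (n : ℝ) ^ (2 * n * (n + 1)) ≤ K63s n k := by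
  unfold K63s
  have h1 : (1 : ℝ) ≤ 9 ^ k * C62 n k := by
    have := two_le_C62 n k
    have h9 : (1 : ℝ) ≤ 9 ^ k := one_le_pow₀ (by norm_num)
    nlinarith
  have h2 : (0 : ℝ) ≤ (n : ℝ) ^ (2 * n * (n + 1)) := by positivity
  nlinarith

/-- `1 ≤ K'(n,k)` (`n ≥ 1`). [folklore] -/
theorem one_le_K63s {n : ℕ} (hn : 1 ≤ n) (k : ℕ) : 1 ≤ K63s n k :=
  le_trans (one_le_pow₀ (by exact_mod_cast hn)) (pow_le_K63s n k)

/-- `K'(n, ·)` is monotone. [folklore] -/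
theorem K63s_mono (n : ℕ) {k k' : ℕ} (h : k ≤ k') : K63s n k ≤ K63s n k' := by
  unfold K63s
  have h1 : (9 : ℝ) ^ k * C62 n k ≤ 9 ^ k' * C62 n k' := by
    have := K63_mono n h; unfold K63 at this; exact this
  exact mul_le_mul_of_nonneg_right h1 (by positivity)

/-- **Ivić, Lemma 6.3 (Vinogradov's mean value theorem), sharp threshold-free form.** For `n ≥ 2`,
`r ≥ 0`, `k ≥ n² + nr` and every `P ≥ 1`,

  `J_{k,n}([1,P]) ≤ K'(n,k)^r · P^{2k − (n²+n)/2 + c_r}`,  `K'(n,k) = 9^k C₆₂(n,k) n^{2n(n+1)}`,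

`c_r = ½(n²+n)(1 − 1/n)^r` (printed constant: `(4n)^{4kr}`). Induction on `r`: for `P ≥ n^{4n}` the
recurrent inequality (`VMV.lemma62`) and the hypothesis at `(k − n, P₁)`; for `P < n^{4n}` Ivić's
(6.32) `J_{k,n}(P) ≤ P^{2n} J_{k−n,n}(P)` and the hypothesis at `(k − n, P)`, with
`P^{c_r − c_{r+1}} = P^{c_r/n} ≤ (n^{4n})^{(n+1)/2} = n^{2n(n+1)}`. [cite: Ivic1985, Lemma 6.3] -/
theorem lemma63_sharp {n : ℕ} (hn : 2 ≤ n) (r : ℕ) :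
    ∀ {k P : ℕ}, n ^ 2 + n * r ≤ k → 1 ≤ P →
      (J n k (Finset.Icc (1 : ℤ) P) : ℝ) ≤
        K63s n k ^ r * (P : ℝ) ^ (2 * (k : ℝ) - ((n : ℝ) ^ 2 + n) / 2 + cr n r) := by
  have hn1 : 1 ≤ n := by omega
  have hn1r : (1 : ℝ) ≤ n := by exact_mod_cast hn1
  have hnr : (0 : ℝ) < n := by positivity
  induction r with
  | zero =>
    intro k P _ hP
    rw [pow_zero, one_mul, cr_zero, show 2 * (k : ℝ) - ((n : ℝ) ^ 2 + n) / 2 + ((n : ℝ) ^ 2 + n) / 2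
      = 2 * (k : ℝ) by ring]
    exact J_Icc_le_rpow n k P
  | succ r ih =>
    intro k P hk hP
    have hP0 : (0 : ℝ) < P := by exact_mod_cast (by omega : 0 < P)
    have hP1 : (1 : ℝ) ≤ P := by exact_mod_cast hP
    have hkn : n ^ 2 + n ≤ k := le_trans (by nlinarith) hk
    have hk' : n ^ 2 + n * r ≤ k - n := by
      have : n ^ 2 + n * (r + 1) = n ^ 2 + n * r + n := by ring
      omega
    have hK1 := one_le_K63s hn1 k
    have hKmono : K63s n (k - n) ^ r ≤ K63s n k ^ r :=
      pow_le_pow_left₀ (by linarith [one_le_K63s hn1 (k - n)]) (K63s_mono n (Nat.sub_le k n)) r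
    set τ : ℝ := 2 * (k : ℝ) - ((n : ℝ) ^ 2 + n) / 2 + cr n (r + 1) with hτ
    -- the exponent at `k - n`
    set ε : ℝ := 2 * ((k - n : ℕ) : ℝ) - ((n : ℝ) ^ 2 + n) / 2 + cr n r with hε
    have hkr : ((k - n : ℕ) : ℝ) = (k : ℝ) - n := by rw [Nat.cast_sub (by omega)]
    have hkn' : (n : ℝ) ^ 2 + n ≤ (k : ℝ) - n + n := by
      have : ((n ^ 2 + n : ℕ) : ℝ) ≤ (k : ℝ) := by exact_mod_cast hkn
      push_cast at this; linarith
    have hε0 : 0 ≤ ε := by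
      rw [hε, hkr]
      have h1 := cr_nonneg hn1 r
      nlinarith
    have hε2k : ε ≤ 2 * (k : ℝ) := by
      rw [hε, hkr]
      have h1 := cr_le hn1 r
      nlinarith
    by_cases hPT : n ^ (4 * n) ≤ P
    · -- large `P`: the recurrent inequality
      obtain ⟨P₁, hP₁1, hlo, hhi, hJ⟩ := lemma62 hn hkn hPT
      have hP₁0 : (0 : ℝ) < P₁ := by exact_mod_cast (by omega : 0 < P₁)
      have hIH := ih hk' hP₁1
      have hQ0 : (0 : ℝ) ≤ (P : ℝ) ^ (1 - 1 / (n : ℝ)) := Real.rpow_nonneg hP0.le _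
      have hP₁ε : (P₁ : ℝ) ^ ε ≤ 9 ^ k * (P : ℝ) ^ ((1 - 1 / (n : ℝ)) * ε) := by
        calc (P₁ : ℝ) ^ ε ≤ (3 * (P : ℝ) ^ (1 - 1 / (n : ℝ))) ^ ε :=
              Real.rpow_le_rpow hP₁0.le hhi hε0
          _ = 3 ^ ε * (P : ℝ) ^ ((1 - 1 / (n : ℝ)) * ε) := by
              rw [Real.mul_rpow (by norm_num) hQ0, ← Real.rpow_mul hP0.le]
          _ ≤ 9 ^ k * (P : ℝ) ^ ((1 - 1 / (n : ℝ)) * ε) := by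
              refine mul_le_mul_of_nonneg_right ?_ (Real.rpow_nonneg hP0.le _)
              calc (3 : ℝ) ^ ε ≤ 3 ^ (2 * (k : ℝ)) :=
                    Real.rpow_le_rpow_of_exponent_le (by norm_num) hε2k
                _ = 9 ^ k := by
                    rw [show (2 * (k : ℝ)) = ((2 * k : ℕ) : ℝ) by push_cast; ring,
                      Real.rpow_natCast, pow_mul]; norm_num
      have hexp : (P : ℝ) ^ (2 * (k : ℝ) / n + (3 * (n : ℝ) - 5) / 2) *
          (P : ℝ) ^ ((1 - 1 / (n : ℝ)) * ε) = (P : ℝ) ^ τ := by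
        rw [← Real.rpow_add hP0]
        congr 1
        rw [hτ, hε, cr_succ, hkr]
        field_simp
        ring
      have hKK : C62 n k * K63s n (k - n) ^ r * 9 ^ k ≤ K63s n k ^ (r + 1) := by
        have h2 : (0 : ℝ) ≤ C62 n k := by linarith [two_le_C62 n k]
        calc C62 n k * K63s n (k - n) ^ r * 9 ^ k = (9 ^ k * C62 n k) * K63s n (k - n) ^ r := by ring
          _ ≤ K63s n k * K63s n k ^ r :=
              mul_le_mul (nine_pow_mul_C62_le_K63s hn1 k) hKmono
                (pow_nonneg (by linarith [one_le_K63s hn1 (k - n)]) r) (by linarith)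
          _ = K63s n k ^ (r + 1) := by ring
      have hC0 : (0 : ℝ) ≤ C62 n k := by linarith [two_le_C62 n k]
      calc (J n k (Finset.Icc (1 : ℤ) P) : ℝ)
          ≤ C62 n k * (P : ℝ) ^ (2 * (k : ℝ) / n + (3 * (n : ℝ) - 5) / 2) *
              J n (k - n) (Finset.Icc 1 (P₁ : ℤ)) := hJ
        _ ≤ C62 n k * (P : ℝ) ^ (2 * (k : ℝ) / n + (3 * (n : ℝ) - 5) / 2) *
              (K63s n (k - n) ^ r * (P₁ : ℝ) ^ ε) :=
            mul_le_mul_of_nonneg_left hIH (by positivity)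
        _ ≤ C62 n k * (P : ℝ) ^ (2 * (k : ℝ) / n + (3 * (n : ℝ) - 5) / 2) *
              (K63s n (k - n) ^ r * (9 ^ k * (P : ℝ) ^ ((1 - 1 / (n : ℝ)) * ε))) := by
            have h0 : (0 : ℝ) ≤ K63s n (k - n) ^ r := by
              have := one_le_K63s hn1 (k - n); positivity
            exact mul_le_mul_of_nonneg_left (mul_le_mul_of_nonneg_left hP₁ε h0) (by positivity)
        _ = (C62 n k * K63s n (k - n) ^ r * 9 ^ k) *
              ((P : ℝ) ^ (2 * (k : ℝ) / n + (3 * (n : ℝ) - 5) / 2) *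
                (P : ℝ) ^ ((1 - 1 / (n : ℝ)) * ε)) := by ring
        _ ≤ K63s n k ^ (r + 1) *
              ((P : ℝ) ^ (2 * (k : ℝ) / n + (3 * (n : ℝ) - 5) / 2) *
                (P : ℝ) ^ ((1 - 1 / (n : ℝ)) * ε)) :=
            mul_le_mul_of_nonneg_right hKK (by positivity)
        _ = _ := by rw [hexp]
    · -- small `P`: Ivić's (6.32) and the induction hypothesis at `(k - n, P)`
      push Not at hPT
      have hPT' : (P : ℝ) ≤ (n : ℝ) ^ (4 * n) := by exact_mod_cast hPT.le
      have hIH := ih hk' hP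
      -- `J_{k,n}([1,P]) ≤ P^{2n} J_{k-n,n}([1,P])`
      have h632 : (J n k (Finset.Icc (1 : ℤ) P) : ℝ) ≤ (P : ℝ) ^ (2 * (n : ℝ)) * J n (k - n) (Finset.Icc (1 : ℤ) P) := by
        have h1 := J_add_le n n (k - n) (Finset.Icc (1 : ℤ) P)
        rw [show n + (k - n) = k by omega, card_Icc_one] at h1
        have h2 : (J n k (Finset.Icc (1 : ℤ) P) : ℝ) ≤ (P : ℝ) ^ (2 * n) * J n (k - n) (Finset.Icc (1 : ℤ) P) := by
          exact_mod_cast h1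
        rwa [show (2 * (n : ℝ)) = ((2 * n : ℕ) : ℝ) by push_cast; ring, Real.rpow_natCast]
      -- the excess exponent `c_r - c_{r+1} = c_r / n ≤ (n+1)/2`
      have hsplit : (P : ℝ) ^ (2 * (n : ℝ)) * (P : ℝ) ^ ε = (P : ℝ) ^ τ * (P : ℝ) ^ (cr n r / n) := by
        rw [← Real.rpow_add hP0, ← Real.rpow_add hP0]
        congr 1
        rw [hτ, hε, cr_succ, hkr]
        field_simp
        ring
      have hex0 : 0 ≤ cr n r / n := div_nonneg (cr_nonneg hn1 r) hnr.le
      have hex1 : cr n r / n ≤ ((n : ℝ) + 1) / 2 := by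
        rw [div_le_iff₀ hnr]
        have := cr_le hn1 r
        nlinarith
      have hsmall : (P : ℝ) ^ (cr n r / n) ≤ (n : ℝ) ^ (2 * n * (n + 1)) := by
        calc (P : ℝ) ^ (cr n r / n) ≤ ((n : ℝ) ^ (4 * n)) ^ (cr n r / n) :=
              Real.rpow_le_rpow hP0.le hPT' hex0
          _ ≤ ((n : ℝ) ^ (4 * n)) ^ (((n : ℝ) + 1) / 2) :=
              Real.rpow_le_rpow_of_exponent_le (one_le_pow₀ hn1r) hex1
          _ = (n : ℝ) ^ (2 * n * (n + 1)) := by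
              rw [← Real.rpow_natCast (n : ℝ) (4 * n), ← Real.rpow_mul (by positivity),
                ← Real.rpow_natCast (n : ℝ) (2 * n * (n + 1))]
              congr 1; push_cast; ring
      have hKK : K63s n (k - n) ^ r * (n : ℝ) ^ (2 * n * (n + 1)) ≤ K63s n k ^ (r + 1) := by
        calc K63s n (k - n) ^ r * (n : ℝ) ^ (2 * n * (n + 1)) ≤ K63s n k ^ r * K63s n k :=
              mul_le_mul hKmono (pow_le_K63s n k) (by positivity) (by positivity)
          _ = K63s n k ^ (r + 1) := by ring
      calc (J n k (Finset.Icc (1 : ℤ) P) : ℝ)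
          ≤ (P : ℝ) ^ (2 * (n : ℝ)) * J n (k - n) (Finset.Icc (1 : ℤ) P) := h632
        _ ≤ (P : ℝ) ^ (2 * (n : ℝ)) * (K63s n (k - n) ^ r * (P : ℝ) ^ ε) :=
            mul_le_mul_of_nonneg_left hIH (by positivity)
        _ = K63s n (k - n) ^ r * ((P : ℝ) ^ (2 * (n : ℝ)) * (P : ℝ) ^ ε) := by ring
        _ = K63s n (k - n) ^ r * ((P : ℝ) ^ τ * (P : ℝ) ^ (cr n r / n)) := by rw [hsplit]
        _ ≤ K63s n (k - n) ^ r * ((P : ℝ) ^ τ * (n : ℝ) ^ (2 * n * (n + 1))) := by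
            have h0 : (0 : ℝ) ≤ K63s n (k - n) ^ r := by
              have := one_le_K63s hn1 (k - n); positivity
            exact mul_le_mul_of_nonneg_left (mul_le_mul_of_nonneg_left hsmall (by positivity)) h0
        _ = (K63s n (k - n) ^ r * (n : ℝ) ^ (2 * n * (n + 1))) * (P : ℝ) ^ τ := by ring
        _ ≤ K63s n k ^ (r + 1) * (P : ℝ) ^ τ := mul_le_mul_of_nonneg_right hKK (by positivity)

/-! ### The size of the constant: `K'(n,k) ≤ (32n)^{3k}` -/

/-- `k^{2n} ≤ 256^k` whenever `n² ≤ k` (with `j = ⌊√k⌋ ≥ n`: `k^{2n} ≤ k^{2j} < (j+1)^{4j} ≤ 2^{4j(j+1)} ≤ 2^{8k}`).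
[folklore] -/
theorem pow_two_mul_le_of_sq_le {n k : ℕ} (h : n ^ 2 ≤ k) : k ^ (2 * n) ≤ 256 ^ k := by
  rcases Nat.eq_zero_or_pos k with rfl | hk0
  · have : n = 0 := by nlinarith
    subst this; simp
  set j := Nat.sqrt k with hj
  have hnj : n ≤ j := by rw [hj, Nat.le_sqrt, ← pow_two]; exact h
  have hkj : k < (j + 1) ^ 2 := by rw [hj, pow_two]; exact Nat.lt_succ_sqrt k
  have hjk : j ≤ k := by rw [hj]; exact Nat.sqrt_le_self k
  have hj2k : j * j ≤ k := by rw [hj]; exact Nat.sqrt_le k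
  calc k ^ (2 * n) ≤ k ^ (2 * j) := Nat.pow_le_pow_right hk0 (by omega)
    _ ≤ ((j + 1) ^ 2) ^ (2 * j) := Nat.pow_le_pow_left hkj.le _
    _ = (j + 1) ^ (4 * j) := by rw [← pow_mul]; ring_nf
    _ ≤ (2 ^ (j + 1)) ^ (4 * j) := Nat.pow_le_pow_left (Nat.lt_two_pow_self).le _
    _ = 2 ^ (4 * j * j + 4 * j) := by rw [← pow_mul]; ring_nf
    _ ≤ 2 ^ (8 * k) := Nat.pow_le_pow_right (by norm_num) (by nlinarith)
    _ = 256 ^ k := by rw [pow_mul]; norm_num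

/-- `C₆₂(n,k) ≤ (3072 n)^k` for `n ≥ 2`, `k ≥ n² + n`. [folklore] -/
theorem C62_le {n k : ℕ} (hn : 2 ≤ n) (hk : n ^ 2 + n ≤ k) : C62 n k ≤ (3072 * (n : ℝ)) ^ k := by
  have hn1r : (1 : ℝ) ≤ n := by exact_mod_cast (by omega : 1 ≤ n)
  have hnk : n ≤ k := by nlinarith
  have hn2k : n * n ≤ k := by nlinarith
  have hk1 : 1 ≤ k := by nlinarith
  unfold C62
  -- `2·9ⁿ ≤ 18^k`
  have h1 : (2 : ℝ) * 9 ^ n ≤ 18 ^ k := by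
    calc (2 : ℝ) * 9 ^ n ≤ 2 ^ k * 9 ^ k := by
          refine mul_le_mul ?_ (pow_le_pow_right₀ (by norm_num) hnk) (by positivity) (by positivity)
          calc (2 : ℝ) = 2 ^ 1 := by norm_num
            _ ≤ 2 ^ k := pow_le_pow_right₀ (by norm_num) hk1
      _ = 18 ^ k := by rw [← mul_pow]; norm_num
  -- `k^{2n} n! 2^{n²} 3ⁿ ≤ 256^k n^k 2^k 3^k = (1536 n)^k`
  have h2 : (k : ℝ) ^ (2 * n) * (Nat.factorial n) * 2 ^ (n * n) * 3 ^ n ≤ (1536 * (n : ℝ)) ^ k := by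
    have e1 : (k : ℝ) ^ (2 * n) ≤ 256 ^ k := by exact_mod_cast pow_two_mul_le_of_sq_le (le_trans (by nlinarith) hk)
    have e2 : (Nat.factorial n : ℝ) ≤ (n : ℝ) ^ k := by
      calc (Nat.factorial n : ℝ) ≤ (n : ℝ) ^ n := by exact_mod_cast Nat.factorial_le_pow n
        _ ≤ (n : ℝ) ^ k := pow_le_pow_right₀ hn1r hnk
    have e3 : (2 : ℝ) ^ (n * n) ≤ 2 ^ k := pow_le_pow_right₀ (by norm_num) hn2k
    have e4 : (3 : ℝ) ^ n ≤ 3 ^ k := pow_le_pow_right₀ (by norm_num) hnk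
    calc (k : ℝ) ^ (2 * n) * (Nat.factorial n) * 2 ^ (n * n) * 3 ^ n
        ≤ 256 ^ k * (n : ℝ) ^ k * 2 ^ k * 3 ^ k := by
          refine mul_le_mul (mul_le_mul (mul_le_mul e1 e2 (by positivity) (by positivity)) e3
            (by positivity) (by positivity)) e4 (by positivity) (by positivity)
      _ = (1536 * (n : ℝ)) ^ k := by
          rw [show (1536 : ℝ) * n = 256 * n * 2 * 3 by ring, mul_pow, mul_pow, mul_pow]
  have h3 : (18 : ℝ) ^ k ≤ (1536 * (n : ℝ)) ^ k :=
    pow_le_pow_left₀ (by norm_num) (by nlinarith) k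
  calc (2 : ℝ) * 9 ^ n + (k : ℝ) ^ (2 * n) * (Nat.factorial n) * 2 ^ (n * n) * 3 ^ n
      ≤ (1536 * (n : ℝ)) ^ k + (1536 * (n : ℝ)) ^ k := add_le_add (h1.trans h3) h2
    _ = 2 * (1536 * (n : ℝ)) ^ k := by ring
    _ ≤ 2 ^ k * (1536 * (n : ℝ)) ^ k := by
        refine mul_le_mul_of_nonneg_right ?_ (by positivity)
        calc (2 : ℝ) = 2 ^ 1 := by norm_num
          _ ≤ 2 ^ k := pow_le_pow_right₀ (by norm_num) hk1
    _ = (3072 * (n : ℝ)) ^ k := by rw [← mul_pow]; ring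

/-- **`K'(n,k) ≤ (32n)^{3k}`** for `n ≥ 2`, `k ≥ n² + n` (`9 · 3072 · n · n² = 27648 n³ ≤ (32n)³`).
[folklore] -/
theorem K63s_le {n k : ℕ} (hn : 2 ≤ n) (hk : n ^ 2 + n ≤ k) : K63s n k ≤ (32 * (n : ℝ)) ^ (3 * k) := by
  have hn1r : (1 : ℝ) ≤ n := by exact_mod_cast (by omega : 1 ≤ n)
  have h2k : 2 * n * (n + 1) ≤ 2 * k := by nlinarith
  unfold K63s
  have h1 := C62_le hn hk
  have h2 : (n : ℝ) ^ (2 * n * (n + 1)) ≤ ((n : ℝ) ^ 2) ^ k := by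
    rw [← pow_mul]; exact pow_le_pow_right₀ hn1r (by linarith)
  have hC0 : (0 : ℝ) ≤ C62 n k := by linarith [two_le_C62 n k]
  calc (9 : ℝ) ^ k * C62 n k * (n : ℝ) ^ (2 * n * (n + 1))
      ≤ 9 ^ k * (3072 * (n : ℝ)) ^ k * ((n : ℝ) ^ 2) ^ k :=
        mul_le_mul (mul_le_mul_of_nonneg_left h1 (by positivity)) h2 (by positivity) (by positivity)
    _ = (27648 * (n : ℝ) ^ 3) ^ k := by rw [← mul_pow, ← mul_pow]; ring
    _ ≤ ((32 * (n : ℝ)) ^ 3) ^ k := by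
        refine pow_le_pow_left₀ (by positivity) ?_ k
        have : (0 : ℝ) ≤ (n : ℝ) ^ 3 := by positivity
        nlinarith
    _ = (32 * (n : ℝ)) ^ (3 * k) := by rw [← pow_mul]

end VMV

/-! ### The interface `VMVTBound` -/

open VMV in
/-- **Vinogradov's mean value theorem in the interface form `VMVTBound 32`**: for all `n ≥ 2`,
`ρ ≥ 0`, `k ≥ n² + nρ` and `P ≥ (32n)^{32n(1+1/(n−1))^ρ}` (indeed for all `P ≥ 1`),
`J_{k,n}([1,P]) ≤ (32n)^{32kρ} P^{2k − ½(n²+n)(1 − (1−1/n)^ρ)}` — Ivić's Lemma 6.3 with `32` for `4`.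
[cite: Ivic1985, Lemma 6.3] -/
theorem vmvtBound_thirtyTwo : VMVTBound 32 := by
  refine vmvtBound_of_forall (fun n ρ k P hn hk hP => ?_) (by norm_num)
  have hn1r : (1 : ℝ) ≤ n := by exact_mod_cast (by omega : 1 ≤ n)
  have hP0 : (0 : ℝ) < P := by exact_mod_cast (by omega : 0 < P)
  have h := lemma63_sharp hn ρ hk hP
  have hexp : (2 * (k : ℝ) - ((n : ℝ) ^ 2 + n) / 2 + cr n ρ) =
      2 * (k : ℝ) - ((n : ℝ) ^ 2 + n) / 2 * (1 - (1 - 1 / (n : ℝ)) ^ ρ) := by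
    unfold cr; ring
  rw [hexp] at h
  refine h.trans (mul_le_mul_of_nonneg_right ?_ (Real.rpow_nonneg hP0.le _))
  -- `K'(n,k)^ρ ≤ (32n)^{32kρ}`
  have hbase : (1 : ℝ) ≤ 32 * n := by nlinarith
  rcases Nat.eq_zero_or_pos ρ with hρ | hρ
  · subst hρ; simp
  have hkn : n ^ 2 + n ≤ k := le_trans (by nlinarith) hk
  calc K63s n k ^ ρ ≤ ((32 * (n : ℝ)) ^ (3 * k)) ^ ρ :=
        pow_le_pow_left₀ (by linarith [one_le_K63s (by omega : 1 ≤ n) k]) (K63s_le hn hkn) ρ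
    _ = (32 * (n : ℝ)) ^ (((3 * k * ρ : ℕ) : ℝ)) := by rw [← pow_mul, Real.rpow_natCast]
    _ ≤ (32 * (n : ℝ)) ^ ((32 : ℝ) * k * ρ) := by
        refine Real.rpow_le_rpow_of_exponent_le hbase ?_
        push_cast
        have : (0 : ℝ) ≤ (k : ℝ) * ρ := by positivity
        nlinarith

/-- **Vinogradov's mean value theorem** (Ivić's Lemma 6.3) **holds in the interface form**:
`∃ A ≥ 1, VMVTBound A`. [cite: Ivic1985, Lemma 6.3] -/
theorem exists_vmvtBound : ∃ A : ℝ, 1 ≤ A ∧ VMVTBound A := ⟨32, by norm_num, vmvtBound_thirtyTwo⟩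

end Literature.NumberTheory.LFunctions
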